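/-
Copyright: pub-rosobs cell (Resolution Observatory), carver gen 49.  Companion file; statements OURS — the
"truncated unipotent operator" computation inside the cell's LEMMA Γ / BOOTSTRAP LEMMA (engine 1 gen 33,
THEOREM-LC §6 (2); CARVER-NOTES-eng1-g33 T12 input (iii)), at the generality of an algebra endomorphism congruent to
the identity modulo an extended ideal.  Instrument — NOT a resolution theorem, NOT a statement about the invariant of
[AbramovichTemkinWlodarczyk2024], NOT summit progress.
-/
import Mathlib.RingTheory.Ideal.Maps
import Mathlib.RingTheory.Ideal.Operations
import Mathlib.Algebra.CharP.Defs
import Mathlib.Algebra.Algebra.Hom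
import HarnessLib

/-!
# Powers of an algebra endomorphism congruent to the identity: `Γ ≡ id (mod I) ⇒ Γ^p ≡ id (mod I²)` in characteristic `p`

Let `A` be a commutative `R`-algebra, `J` an ideal of `R`, `I = J·A` its extension, and `Γ : A →ₐ[R] A` with
`Γ(a) − a ∈ I` for all `a` ("`Γ ≡ id mod I`").  Writing `E = Γ − id`:

* `apply_sub_self_mem_sq_of_mem` : `E(I) ⊆ I²` (because `Γ` is `R`-linear and `I` is generated by `J ⊆ R`);
* `iterate_sub_sub_nsmul_mem_sq` : `Γ^m(a) − a − m·E(a) ∈ I²` for every `m` (the binomial expansion of `(id + E)^m`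
  truncated after the linear term);
* `iterate_char_sub_self_mem_sq` : in characteristic `p`, **`Γ^p ≡ id (mod I²)`**;
* `iterate_pred_char_comp_sub_self_mem` : if moreover `Γ' ≡ id (mod I)` and `Γ' ≡ Γ (mod I')`, then
  **`Γ^{p−1} ∘ Γ' ≡ id (mod I' + I²)`**;
* the cell's instance `J = (s²)`, `I' = (s³)·A` (`s = σ`, `Γ = Γ_σ = Φ_σ ∘ Φ_{−σ}`, `Γ' = Γ_{−σ}`):
  `iterate_char_sub_self_mem_span_cube`, `iterate_pred_char_comp_sub_self_mem_span_cube` — both maps are `≡ id (mod σ³)`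
  (in fact `Γ^p ≡ id (mod σ⁴)`, `iterate_char_sub_self_mem_span_fourth`).

This is the operator form of the classical "`a ≡ b (mod 𝔞ₙ) ⇒ a^p ≡ b^p (mod 𝔞ₙ₊₁)` by the binomial formula, since
`p ∈ 𝔞₁`" [cite: SerreLocalFields1979, Ch. II §4 Lemma 1]; here `p = 0` in `A`, so the linear term `p·E` vanishes
outright.  What is NOT typed here: the cell-specific facts that `Γ_σ := Φ_σ ∘ Φ_{−σ}` is again a graded isotropy with
`Γ_σ ≡ id (mod σ²)` and pure part `2cσ²` on the slot `a` (T9 (F2), LEMMA Γ (a)–(b)) — they need the graded-isotropy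
formalism and are separate targets.  Formalisation ours.
-/

namespace Literature.AlgebraicGeometry.Resolution.WeightedBlowup

section General

variable {R : Type*} [CommRing R] {A : Type*} [CommRing A] [Algebra R A]

/-- **`E(I) ⊆ I²`**: if `Γ ≡ id (mod J·A)` then `Γ(a) − a ∈ (J·A)²` for every `a ∈ J·A` (derived here; `Γ` fixes
`J ⊆ R` pointwise). [cite: SerreLocalFields1979, Ch. II §4 Lemma 1] -/
theorem apply_sub_self_mem_sq_of_mem (J : Ideal R) (Γ : A →ₐ[R] A)
    (hΓ : ∀ a, Γ a - a ∈ J.map (algebraMap R A)) {a : A} (ha : a ∈ J.map (algebraMap R A)) :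
    Γ a - a ∈ J.map (algebraMap R A) ^ 2 := by
  set I := J.map (algebraMap R A) with hI
  refine Submodule.span_induction (p := fun x _ => Γ x - x ∈ I ^ 2) ?_ ?_ ?_ ?_ ha
  · rintro _ ⟨r, hr, rfl⟩
    rw [AlgHom.commutes, sub_self]
    exact zero_mem _
  · rw [map_zero, sub_self]
    exact zero_mem _
  · intro x y _ _ hx hy
    have : Γ (x + y) - (x + y) = (Γ x - x) + (Γ y - y) := by rw [map_add]; abel
    rw [this]
    exact add_mem hx hy
  · intro b x hx hbx
    have : Γ (b • x) - b • x = Γ b * (Γ x - x) + (Γ b - b) * x := by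
      rw [smul_eq_mul, map_mul]; ring
    rw [this, pow_two]
    exact add_mem (Ideal.mul_mem_left _ _ (by rw [← pow_two]; exact hbx)) (Ideal.mul_mem_mul (hΓ b) hx)

/-- **Truncated binomial expansion**: `Γ^m(a) − a − m·(Γ(a) − a) ∈ (J·A)²` for every `m` (derived here;
`(id + E)^m ≡ id + m·E` modulo `E(I) + E²`). [cite: SerreLocalFields1979, Ch. II §4 Lemma 1] -/
theorem iterate_sub_sub_nsmul_mem_sq (J : Ideal R) (Γ : A →ₐ[R] A)
    (hΓ : ∀ a, Γ a - a ∈ J.map (algebraMap R A)) (m : ℕ) (a : A) :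
    (⇑Γ)^[m] a - a - m • (Γ a - a) ∈ J.map (algebraMap R A) ^ 2 := by
  set I := J.map (algebraMap R A) with hI
  induction m with
  | zero => simp
  | succ m ih =>
    set b := (⇑Γ)^[m] a with hb
    have hba : b - a ∈ I := by
      have h := add_mem (Ideal.pow_le_self two_ne_zero ih) (nsmul_mem (hΓ a) m)
      rwa [sub_add_cancel] at h
    have key : (⇑Γ)^[m + 1] a - a - (m + 1) • (Γ a - a) = (Γ (b - a) - (b - a)) + (b - a - m • (Γ a - a)) := by
      rw [Function.iterate_succ_apply', ← hb, map_sub, add_smul, one_smul]; abel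
    rw [key]
    exact add_mem (apply_sub_self_mem_sq_of_mem J Γ hΓ hba) ih

/-- **`Γ ≡ id (mod I) ⇒ Γ^p ≡ id (mod I²)` in characteristic `p`** (derived here; the linear term `p·E(a)` vanishes).
[cite: SerreLocalFields1979, Ch. II §4 Lemma 1] -/
theorem iterate_char_sub_self_mem_sq (p : ℕ) [CharP A p] (J : Ideal R) (Γ : A →ₐ[R] A)
    (hΓ : ∀ a, Γ a - a ∈ J.map (algebraMap R A)) (a : A) :
    (⇑Γ)^[p] a - a ∈ J.map (algebraMap R A) ^ 2 := by
  have h := iterate_sub_sub_nsmul_mem_sq J Γ hΓ p a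
  rwa [← Nat.cast_smul_eq_nsmul A, CharP.cast_eq_zero, zero_smul, sub_zero] at h

/-- The same for the monoid power `Γ ^ p` of `A →ₐ[R] A` (plumbing). [cite: SerreLocalFields1979, Ch. II §4 Lemma 1] -/
theorem pow_char_apply_sub_self_mem_sq (p : ℕ) [CharP A p] (J : Ideal R) (Γ : A →ₐ[R] A)
    (hΓ : ∀ a, Γ a - a ∈ J.map (algebraMap R A)) (a : A) :
    (Γ ^ p) a - a ∈ J.map (algebraMap R A) ^ 2 := by
  rw [AlgHom.coe_pow]
  exact iterate_char_sub_self_mem_sq p J Γ hΓ a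

/-- **`Γ^{p−1} ∘ Γ' ≡ id (mod I' + I²)`** for `Γ, Γ' ≡ id (mod I)` with `Γ' ≡ Γ (mod I')`, in characteristic `p`
(derived here; `(p−1)·E = −E` and `E(Γ'a − a) ∈ I²`; the cell's `Γ_σ^{p−1} ∘ Γ_{−σ}`).
[cite: SerreLocalFields1979, Ch. II §4 Lemma 1] -/
theorem iterate_pred_char_comp_sub_self_mem (p : ℕ) [hp : Fact p.Prime] [CharP A p] (J : Ideal R)
    (I' : Ideal A) (Γ Γ' : A →ₐ[R] A) (hΓ : ∀ a, Γ a - a ∈ J.map (algebraMap R A))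
    (hΓ' : ∀ a, Γ' a - a ∈ J.map (algebraMap R A)) (hd : ∀ a, Γ' a - Γ a ∈ I') (a : A) :
    (⇑Γ)^[p - 1] (Γ' a) - a ∈ I' ⊔ J.map (algebraMap R A) ^ 2 := by
  set I := J.map (algebraMap R A) with hI
  set c := Γ' a with hc
  have h1 := iterate_sub_sub_nsmul_mem_sq J Γ hΓ (p - 1) c
  -- `(p - 1) • E c = -E c` in characteristic `p`
  have hsm : (p - 1) • (Γ c - c) = -(Γ c - c) := by
    have hp1 : p - 1 + 1 = p := Nat.sub_add_cancel hp.out.one_le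
    have h0 : p • (Γ c - c) = 0 := by
      rw [← Nat.cast_smul_eq_nsmul A, CharP.cast_eq_zero, zero_smul]
    have h := congrArg (fun n : ℕ => n • (Γ c - c)) hp1
    simp only [add_smul, one_smul, h0] at h
    exact eq_neg_of_add_eq_zero_left h
  have hca : c - a ∈ I := hΓ' a
  have h2 : Γ (c - a) - (c - a) ∈ I ^ 2 := apply_sub_self_mem_sq_of_mem J Γ hΓ hca
  have key : (⇑Γ)^[p - 1] c - a
      = ((⇑Γ)^[p - 1] c - c - (p - 1) • (Γ c - c)) + (c - Γ a) - (Γ (c - a) - (c - a)) := by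
    rw [hsm, map_sub]; abel
  rw [key]
  refine sub_mem (add_mem (Ideal.mem_sup_right h1) (Ideal.mem_sup_left ?_)) (Ideal.mem_sup_right h2)
  simpa [hc] using hd a

end General

/-! ## The cell's instance: `J = (σ²)`, congruences modulo `σ³` and `σ⁴` -/

section Cell

variable {R : Type*} [CommRing R] {A : Type*} [CommRing A] [Algebra R A]

/-- `((s²)·A)² ≤ (s⁴)·A` and `≤ (s³)·A` (plumbing). [cite: SerreLocalFields1979, Ch. II §4 Lemma 1] -/
theorem map_span_sq_pow_two_le (s : R) (n : ℕ) (hn : n ≤ 4) :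
    (Ideal.span {s ^ 2}).map (algebraMap R A) ^ 2 ≤ (Ideal.span {s ^ n}).map (algebraMap R A) := by
  rw [← Ideal.map_pow, Ideal.span_singleton_pow, ← pow_mul]
  exact Ideal.map_mono (Ideal.span_singleton_le_span_singleton.mpr (pow_dvd_pow s (by omega)))

/-- **LEMMA Γ, computation (c), first map**: if `Γ ≡ id (mod σ²)` then `Γ^p ≡ id (mod σ⁴)` in characteristic `p`
(derived here; `Γ = Γ_σ`). [cite: SerreLocalFields1979, Ch. II §4 Lemma 1] -/
theorem iterate_char_sub_self_mem_span_fourth (p : ℕ) [CharP A p] (s : R) (Γ : A →ₐ[R] A)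
    (hΓ : ∀ a, Γ a - a ∈ (Ideal.span {s ^ 2}).map (algebraMap R A)) (a : A) :
    (⇑Γ)^[p] a - a ∈ (Ideal.span {s ^ 4}).map (algebraMap R A) :=
  map_span_sq_pow_two_le s 4 le_rfl (iterate_char_sub_self_mem_sq p _ Γ hΓ a)

/-- … hence `Γ^p ≡ id (mod σ³)` (derived here; the form used in the BOOTSTRAP LEMMA step (2)).
[cite: SerreLocalFields1979, Ch. II §4 Lemma 1] -/
theorem iterate_char_sub_self_mem_span_cube (p : ℕ) [CharP A p] (s : R) (Γ : A →ₐ[R] A)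
    (hΓ : ∀ a, Γ a - a ∈ (Ideal.span {s ^ 2}).map (algebraMap R A)) (a : A) :
    (⇑Γ)^[p] a - a ∈ (Ideal.span {s ^ 3}).map (algebraMap R A) :=
  map_span_sq_pow_two_le s 3 (by norm_num) (iterate_char_sub_self_mem_sq p _ Γ hΓ a)

/-- **LEMMA Γ, computation (c), second map**: if `Γ, Γ' ≡ id (mod σ²)` and `Γ' ≡ Γ (mod σ³)` then
`Γ^{p−1} ∘ Γ' ≡ id (mod σ³)` in characteristic `p` (derived here; `Γ = Γ_σ`, `Γ' = Γ_{−σ}`).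
[cite: SerreLocalFields1979, Ch. II §4 Lemma 1] -/
theorem iterate_pred_char_comp_sub_self_mem_span_cube (p : ℕ) [Fact p.Prime] [CharP A p] (s : R)
    (Γ Γ' : A →ₐ[R] A) (hΓ : ∀ a, Γ a - a ∈ (Ideal.span {s ^ 2}).map (algebraMap R A))
    (hΓ' : ∀ a, Γ' a - a ∈ (Ideal.span {s ^ 2}).map (algebraMap R A))
    (hd : ∀ a, Γ' a - Γ a ∈ (Ideal.span {s ^ 3}).map (algebraMap R A)) (a : A) :
    (⇑Γ)^[p - 1] (Γ' a) - a ∈ (Ideal.span {s ^ 3}).map (algebraMap R A) := by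
  have hle : (Ideal.span {s ^ 3}).map (algebraMap R A) ⊔ (Ideal.span {s ^ 2}).map (algebraMap R A) ^ 2
      ≤ (Ideal.span {s ^ 3}).map (algebraMap R A) :=
    sup_le le_rfl (map_span_sq_pow_two_le s 3 (by norm_num))
  exact hle (iterate_pred_char_comp_sub_self_mem p _ _ Γ Γ' hΓ hΓ' hd a)

end Cell

end Literature.AlgebraicGeometry.Resolution.WeightedBlowup
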